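import Mathlib
import HarnessLib
import Summits.AtomisticToContinuum.Crystallization.Theorems.PricedLinkCensusSoftFourRingsRigCellSound1

/-!
# Soft four-rings, metric half by certified numerics (8): soundness of the cell checker, II

Route `PricedLinkCensus`, sub-problem `Crystallization`, item `SoftFourRings`
(stmt-AtomisticToContinuum-14234).  The deviation test (`applyObjective_sound`: an accepted
objective instruction exhibits an orthogonal matrix `R` — the rational rotation of the integer
quaternion, possibly composed with the reflection `z ↦ −z` — with
`|x i − R (tab i/√N)| ≤ 6/25` for every point), the replay induction (`runInstrs_sound`) and the
main theorem of the checker, `runCell_sound`: if `runCell m c = true` then every feasible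
configuration in the normal form of the cell `c` is `6/25`-close, label by label, to an
orthogonal image of the pattern.
-/

namespace Summit.AtomisticToContinuum.Crystallization.Theorems

namespace Rig

open Literature.Analysis.ValidatedNumerics.NumericsMP
open scoped Matrix

/-! ### The conclusion -/

/-- **`6/25`-closeness to an orthogonal image of the pattern**, label by label: an orthogonal
`3 × 3` real matrix `R` (columns orthonormal) with `Σ_k (x i k − (R · tab i/√N) k)² ≤ (6/25)²`. -/
def CloseTo (m : Model) (x : Fin 12 → Fin 3 → ℝ) : Prop :=
  ∃ R : Fin 3 → Fin 3 → ℝ, (∀ i j, (∑ k, R k i * R k j) = if i = j then 1 else 0) ∧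
    ∀ i, (∑ k, (x i k - ∑ l, R k l * ((m.tab i l : ℝ) / Real.sqrt m.normSq)) ^ 2) ≤ (6 / 25) ^ 2

/-! ### The quaternion rotation -/

/-- `Mᵀ M = n² · 1` for the integer quaternion matrix (with or without the `z`-reflection). -/
theorem quatMat_orth (w x y z : ℤ) (refl : Bool) (i j : Fin 3) :
    (∑ k, quatMat w x y z refl k i * quatMat w x y z refl k j) =
      if i = j then quatNorm w x y z ^ 2 else 0 := by
  cases refl <;> fin_cases i <;> fin_cases j <;>
    simp [quatMat, quatNorm, Fin.sum_univ_three] <;> ring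

/-- The real rotation `R = M/n`. -/
noncomputable def quatR (w x y z : ℤ) (refl : Bool) : Fin 3 → Fin 3 → ℝ :=
  fun i j => (quatMat w x y z refl i j : ℝ) / quatNorm w x y z

/-- `R` has orthonormal columns when `n ≠ 0`. -/
theorem quatR_orth {w x y z : ℤ} (refl : Bool) (hn : 0 < quatNorm w x y z) (i j : Fin 3) :
    (∑ k, quatR w x y z refl k i * quatR w x y z refl k j) = if i = j then 1 else 0 := by
  have hn0 : (quatNorm w x y z : ℝ) ≠ 0 := by exact_mod_cast hn.ne'
  have h := quatMat_orth w x y z refl i j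
  have h' : (∑ k, (quatMat w x y z refl k i : ℝ) * quatMat w x y z refl k j) =
      if i = j then (quatNorm w x y z : ℝ) ^ 2 else 0 := by
    by_cases hij : i = j
    · rw [if_pos hij] at h ⊢; exact_mod_cast h
    · rw [if_neg hij] at h ⊢; exact_mod_cast h
  unfold quatR
  have : (∑ k, (quatMat w x y z refl k i : ℝ) / quatNorm w x y z *
      ((quatMat w x y z refl k j : ℝ) / quatNorm w x y z)) =
      (∑ k, (quatMat w x y z refl k i : ℝ) * quatMat w x y z refl k j) / (quatNorm w x y z : ℝ) ^ 2 := by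
    rw [Finset.sum_div]; refine Finset.sum_congr rfl fun k _ => ?_; field_simp
  rw [this, h']
  by_cases hij : i = j
  · rw [if_pos hij, if_pos hij]; field_simp
  · rw [if_neg hij, if_neg hij]; simp

/-! ### Elementary estimates for the deviation test -/

/-- `|y − t| ≤ max |a − t| |b − t|` for `y ∈ [a, b]`. -/
theorem abs_sub_le_max_ends {a b y t : ℝ} (ha : a ≤ y) (hb : y ≤ b) : |y - t| ≤ max |a - t| |b - t| := by
  rcases le_or_gt t y with h | h
  · rw [abs_of_nonneg (by linarith)]
    exact le_trans (by linarith) ((le_abs_self (b - t)).trans (le_max_right _ _))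
  · rw [abs_of_neg (by linarith)]
    have : -(y - t) ≤ |a - t| := by
      rw [abs_sub_comm]; exact le_trans (by linarith) (le_abs_self _)
    exact this.trans (le_max_left _ _)

/-- `p √N ≤ S` for `p = invSqrtLo N`. -/
theorem invSqrtLo_le {N : ℕ} (hN : 0 < N) : (invSqrtLo N : ℝ) * Real.sqrt N ≤ SC := by
  have hNr : (0 : ℝ) < N := by exact_mod_cast hN
  have hNz : (0 : ℤ) < N := by exact_mod_cast hN
  have hsN : 0 < Real.sqrt N := Real.sqrt_pos.2 hNr
  unfold invSqrtLo
  set M : ℤ := (SC : ℤ) * SC / N with hM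
  have hM0 : 0 ≤ M := Int.ediv_nonneg (by positivity) hNz.le
  have hp0 : (0 : ℝ) ≤ Int.sqrt M := by exact_mod_cast Int.sqrt_nonneg _
  have h1 : ((Int.sqrt M : ℤ) : ℝ) ^ 2 ≤ M := int_sqrt_sq_le hM0
  have h2 : (M : ℝ) ≤ (SC : ℝ) * SC / N := by
    have := Literature.Analysis.ValidatedNumerics.Numerics.fdiv_le_div (a := (SC : ℤ) * SC) hNz
    rw [hM]; push_cast at this ⊢; exact this
  -- `(p √N)² ≤ S²`
  have h3 : ((Int.sqrt M : ℤ) : ℝ) * Real.sqrt N ≤ SC := by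
    have hsq : (((Int.sqrt M : ℤ) : ℝ) * Real.sqrt N) ^ 2 ≤ (SC : ℝ) ^ 2 := by
      rw [mul_pow, Real.sq_sqrt hNr.le]
      have : ((Int.sqrt M : ℤ) : ℝ) ^ 2 * N ≤ (SC : ℝ) * SC / N * N := by
        exact mul_le_mul_of_nonneg_right (h1.trans h2) hNr.le
      rw [div_mul_cancel₀ _ hNr.ne'] at this
      nlinarith
    have hS : (0 : ℝ) ≤ SC := by exact_mod_cast SC_pos.le
    exact (sq_le_sq₀ (mul_nonneg hp0 hsN.le) hS).mp hsq
  exact h3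

/-- `S ≤ q √N` for `q = invSqrtHi N`. -/
theorem le_invSqrtHi {N : ℕ} (hN : 0 < N) : (SC : ℝ) ≤ (invSqrtHi N : ℝ) * Real.sqrt N := by
  have hNr : (0 : ℝ) < N := by exact_mod_cast hN
  have hNz : (0 : ℤ) < N := by exact_mod_cast hN
  have hsN : 0 < Real.sqrt N := Real.sqrt_pos.2 hNr
  unfold invSqrtHi
  set M : ℤ := (SC : ℤ) * SC / N with hM
  have hM0 : 0 ≤ M := Int.ediv_nonneg (by positivity) hNz.le
  have hM1 : 0 ≤ M + 1 := by linarith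
  -- `S²/N < M + 1`
  have h1 : (SC : ℝ) * SC / N < (M : ℝ) + 1 := by
    have h0 := Int.lt_ediv_add_one_mul_self ((SC : ℤ) * SC) hNz
    have h0r : ((SC : ℤ) * SC : ℝ) < (((SC : ℤ) * SC / N + 1 : ℤ) : ℝ) * (N : ℝ) := by exact_mod_cast h0
    rw [div_lt_iff₀ hNr]
    rw [hM]; push_cast at h0r ⊢; linarith
  have h2 : ((M + 1 : ℤ) : ℝ) < ((Int.sqrt (M + 1) : ℤ) + 1 : ℝ) ^ 2 := lt_int_sqrt_succ_sq hM1
  have hq0 : (0 : ℝ) ≤ (Int.sqrt (M + 1) : ℤ) + 1 := by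
    have : (0 : ℝ) ≤ (Int.sqrt (M + 1) : ℤ) := by exact_mod_cast Int.sqrt_nonneg _
    linarith
  have hsq : (SC : ℝ) ^ 2 ≤ (((Int.sqrt (M + 1) : ℤ) + 1 : ℝ) * Real.sqrt N) ^ 2 := by
    rw [mul_pow, Real.sq_sqrt hNr.le]
    push_cast at h2
    have : (SC : ℝ) * SC ≤ ((M : ℝ) + 1) * N := by
      rw [div_lt_iff₀ hNr] at h1; linarith
    nlinarith
  have hS : (0 : ℝ) ≤ SC := by exact_mod_cast SC_pos.le
  push_cast
  exact (sq_le_sq₀ hS (mul_nonneg hq0 hsN.le)).mp hsq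

/-! ### The deviation test -/

/-- The certified coordinate window: `x i k · S ∈ [C − L, C + U]`. -/
theorem coord_window {m : Model} {x : Fin 12 → Fin 3 → ℝ} (hF : Feasible m.bond x) {bx : Boxes}
    (hx : bx.mem x) {i : Fin 12} (hi : bx.placed i = true) (k : Fin 3) (cu cl : Cert) :
    (bx.C i k : ℝ) - certUpper bx (rowsOf m.bond bx).toArray (unitObj i k false) cl ≤ x i k * SC ∧
    x i k * SC ≤ (bx.C i k : ℝ) + certUpper bx (rowsOf m.bond bx).toArray (unitObj i k true) cu := by
  have hS : (0 : ℝ) < SC := by exact_mod_cast SC_pos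
  have hrows : ∀ r ∈ (rowsOf m.bond bx).toArray, r.Holds (bx.disp x) :=
    fun r hr => rows_hold hF hx r (List.mem_toArray.1 hr)
  have hd := Boxes.dispIn_of_mem hx
  have hU := certUpper_sound hrows hd (unitObj i k true) cu
  have hL := certUpper_sound hrows hd (unitObj i k false) cl
  rw [sum_unitObj] at hU hL
  have hdisp : bx.disp x i k = x i k - (bx.C i k : ℝ) / SC := by simp [Boxes.disp, hi, Boxes.c]
  rw [hdisp] at hU hL
  simp only [if_true, one_mul, Bool.false_eq_true, if_false, neg_one_mul] at hU hL
  rw [le_div_iff₀ hS] at hU hL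
  constructor
  · have : -(x i k - (bx.C i k : ℝ) / SC) * SC = -(x i k * SC) + bx.C i k := by field_simp; ring
    linarith [hL, this]
  · have : (x i k - (bx.C i k : ℝ) / SC) * SC = x i k * SC - bx.C i k := by field_simp
    linarith [hU, this]

/-- One coordinate of the deviation: `n S |x − u| ≤ devCoord`. -/
theorem devCoord_bound {α β n w p q : ℤ} {e t : ℝ} (hn : (0 : ℝ) ≤ n)
    (he1 : (α : ℝ) ≤ e) (he2 : e ≤ β) (ht : min ((w : ℝ) * p) ((w : ℝ) * q) ≤ t ∧ t ≤ max ((w : ℝ) * p) ((w : ℝ) * q)) :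
    |e * n - t| ≤ (devCoord α β n w p q : ℝ) := by
  unfold devCoord
  push_cast
  have h1 : |e * n - t| ≤ max |(α : ℝ) * n - t| |(β : ℝ) * n - t| :=
    abs_sub_le_max_ends (mul_le_mul_of_nonneg_right he1 hn) (mul_le_mul_of_nonneg_right he2 hn)
  -- now bound each `|c − t|` by the ends of `t`'s interval
  have key : ∀ c : ℝ, |c - t| ≤ max |c - w * p| |c - w * q| := by
    intro c
    rcases le_total ((w : ℝ) * p) ((w : ℝ) * q) with hle | hle
    · rw [min_eq_left hle, max_eq_right hle] at ht
      have := abs_sub_le_max_ends (a := (w : ℝ) * p) (b := (w : ℝ) * q) (y := t) (t := c) ht.1 ht.2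
      rw [abs_sub_comm] at this
      rwa [abs_sub_comm ((w:ℝ) * p) c, abs_sub_comm ((w:ℝ) * q) c] at this
    · rw [min_eq_right hle, max_eq_left hle] at ht
      have := abs_sub_le_max_ends (a := (w : ℝ) * q) (b := (w : ℝ) * p) (y := t) (t := c) ht.1 ht.2
      rw [abs_sub_comm] at this
      rw [abs_sub_comm ((w:ℝ) * q) c, abs_sub_comm ((w:ℝ) * p) c] at this
      rwa [max_comm] at this
  calc |e * n - t| ≤ max |(α : ℝ) * n - t| |(β : ℝ) * n - t| := h1
    _ ≤ max (max |(α : ℝ) * n - w * p| |(α : ℝ) * n - w * q|) (max |(β : ℝ) * n - w * p| |(β : ℝ) * n - w * q|) :=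
        max_le_max (key _) (key _)

/-- **Soundness of the deviation test at one point.** -/
theorem devTest_sound {m : Model} (hN : 0 < m.normSq) {x : Fin 12 → Fin 3 → ℝ} (hF : Feasible m.bond x)
    {bx : Boxes} (hx : bx.mem x) {i : Fin 12} (hi : bx.placed i = true)
    {w qx qy qz : ℤ} {refl : Bool} (hn : 0 < quatNorm w qx qy qz) (certs : List Cert)
    (h : devTest m bx (rowsOf m.bond bx).toArray (quatMat w qx qy qz refl) (quatNorm w qx qy qz) i certs = true) :
    (∑ k, (x i k - ∑ l, quatR w qx qy qz refl k l * ((m.tab i l : ℝ) / Real.sqrt m.normSq)) ^ 2) ≤ (6 / 25) ^ 2 := by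
  have hS : (0 : ℝ) < SC := by exact_mod_cast SC_pos
  have hnr : (0 : ℝ) < quatNorm w qx qy qz := by exact_mod_cast hn
  have hNr : (0 : ℝ) < m.normSq := by exact_mod_cast hN
  have hsN : 0 < Real.sqrt m.normSq := Real.sqrt_pos.2 hNr
  set n := quatNorm w qx qy qz with hndef
  set p := invSqrtLo m.normSq with hpdef
  set q := invSqrtHi m.normSq with hqdef
  set Mq := quatMat w qx qy qz refl with hMqdef
  set rows := (rowsOf m.bond bx).toArray with hrowsdef
  -- the integer deviation bounds of the test
  set Mk : Fin 3 → ℤ := fun k =>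
    devCoord (bx.C i k - certUpper bx rows (unitObj i k false) (certs.getD (2 * k.val + 1) (1, [])))
      (bx.C i k + certUpper bx rows (unitObj i k true) (certs.getD (2 * k.val) (1, [])))
      n (∑ l, Mq k l * m.tab i l) p q with hMk
  have htest : 625 * ∑ k, Mk k * Mk k ≤ 36 * (n * SC) * (n * SC) := by
    unfold devTest at h
    rw [decide_eq_true_eq] at h
    dsimp only at h
    exact h
  have hp := invSqrtLo_le hN
  have hq := le_invSqrtHi hN
  -- the per-coordinate bound
  have hcoord : ∀ k : Fin 3,
      (n : ℝ) * SC * |x i k - ∑ l, quatR w qx qy qz refl k l * ((m.tab i l : ℝ) / Real.sqrt m.normSq)| ≤ (Mk k : ℝ) := by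
    intro k
    obtain ⟨h1, h2⟩ := coord_window hF hx hi k (certs.getD (2 * k.val) (1, []))
      (certs.getD (2 * k.val + 1) (1, []))
    rw [← hrowsdef] at h1 h2
    set wk : ℤ := ∑ l, Mq k l * m.tab i l with hwk
    -- `u · n · S = wk · (S/√N)`
    have hu : (∑ l, quatR w qx qy qz refl k l * ((m.tab i l : ℝ) / Real.sqrt m.normSq)) * n * SC =
        (wk : ℝ) * (SC / Real.sqrt m.normSq) := by
      have hn0 : (n : ℝ) ≠ 0 := hnr.ne'
      have hs0 : Real.sqrt m.normSq ≠ 0 := hsN.ne'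
      rw [hwk]
      push_cast
      rw [Finset.sum_mul, Finset.sum_mul, Finset.sum_mul]
      refine Finset.sum_congr rfl fun l _ => ?_
      simp only [quatR, ← hndef, ← hMqdef]
      field_simp
    have ht : min ((wk : ℝ) * p) ((wk : ℝ) * q) ≤ (wk : ℝ) * (SC / Real.sqrt m.normSq) ∧
        (wk : ℝ) * (SC / Real.sqrt m.normSq) ≤ max ((wk : ℝ) * p) ((wk : ℝ) * q) := by
      have hlo : (p : ℝ) ≤ SC / Real.sqrt m.normSq := by rw [le_div_iff₀ hsN]; exact hp
      have hhi : SC / Real.sqrt m.normSq ≤ (q : ℝ) := by rw [div_le_iff₀ hsN]; exact hq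
      rcases le_or_gt 0 (wk : ℝ) with hw | hw
      · constructor
        · exact (min_le_left _ _).trans (mul_le_mul_of_nonneg_left hlo hw)
        · exact (mul_le_mul_of_nonneg_left hhi hw).trans (le_max_right _ _)
      · constructor
        · exact (min_le_right _ _).trans (mul_le_mul_of_nonpos_left hhi hw.le)
        · exact (mul_le_mul_of_nonpos_left hlo hw.le).trans (le_max_left _ _)
    have hdev := devCoord_bound
      (α := bx.C i k - certUpper bx rows (unitObj i k false) (certs.getD (2 * k.val + 1) (1, [])))
      (β := bx.C i k + certUpper bx rows (unitObj i k true) (certs.getD (2 * k.val) (1, [])))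
      (w := wk) (p := p) (q := q)
      (e := x i k * SC) (n := n) hnr.le (by push_cast; exact h1) (by push_cast; exact h2) ht
    have heq : x i k * SC * n - (wk : ℝ) * (SC / Real.sqrt m.normSq) =
        (n : ℝ) * SC * (x i k - ∑ l, quatR w qx qy qz refl k l * ((m.tab i l : ℝ) / Real.sqrt m.normSq)) := by
      rw [← hu]; ring
    rw [heq, abs_mul, abs_of_pos (by positivity)] at hdev
    rw [hMk]
    exact hdev
  -- sum the squares
  have hsum : (n : ℝ) ^ 2 * (SC : ℝ) ^ 2 *
      (∑ k, (x i k - ∑ l, quatR w qx qy qz refl k l * ((m.tab i l : ℝ) / Real.sqrt m.normSq)) ^ 2) ≤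
      ∑ k : Fin 3, (Mk k : ℝ) ^ 2 := by
    rw [Finset.mul_sum]
    refine Finset.sum_le_sum fun k _ => ?_
    have hk := hcoord k
    have h0 : 0 ≤ (n : ℝ) * SC * |x i k - ∑ l, quatR w qx qy qz refl k l * ((m.tab i l : ℝ) / Real.sqrt m.normSq)| := by
      positivity
    have := pow_le_pow_left₀ h0 hk 2
    rw [mul_pow, mul_pow, sq_abs] at this
    linarith
  have htest' : (625 : ℝ) * ∑ k : Fin 3, (Mk k : ℝ) ^ 2 ≤ 36 * ((n : ℝ) * SC) * ((n : ℝ) * SC) := by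
    have h' : ((625 * ∑ k, Mk k * Mk k : ℤ) : ℝ) ≤ ((36 * (n * SC) * (n * SC) : ℤ) : ℝ) := by exact_mod_cast htest
    push_cast at h'
    simp only [sq]
    exact h'
  have hpos : (0 : ℝ) < (n : ℝ) ^ 2 * (SC : ℝ) ^ 2 := by positivity
  have : (n : ℝ) ^ 2 * (SC : ℝ) ^ 2 *
      (∑ k, (x i k - ∑ l, quatR w qx qy qz refl k l * ((m.tab i l : ℝ) / Real.sqrt m.normSq)) ^ 2) ≤
      (n : ℝ) ^ 2 * (SC : ℝ) ^ 2 * (6 / 25) ^ 2 := by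
    nlinarith [hsum, htest']
  exact le_of_mul_le_mul_left this hpos

/-- **Soundness of the objective instruction.** -/
theorem applyObjective_sound {m : Model} (hN : 0 < m.normSq) {x : Fin 12 → Fin 3 → ℝ}
    (hF : Feasible m.bond x) {bx : Boxes} (hx : bx.mem x) (st : List Step) (qw qx qy qz : ℤ)
    (refl : Bool) (certs : List Cert)
    (h : applyObjective m bx st qw qx qy qz refl certs = Outcome.verified) : CloseTo m x := by
  unfold applyObjective at h
  by_cases hcond : (st.isEmpty && (List.finRange 12).all (fun v => bx.placed v) && decide (0 < quatNorm qw qx qy qz)) = true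
  · rw [if_pos hcond] at h
    simp only [Bool.and_eq_true, List.all_eq_true, decide_eq_true_eq] at hcond
    obtain ⟨⟨-, hall⟩, hn⟩ := hcond
    by_cases htest : ((List.finRange 12).all fun i => devTest m bx (rowsOf m.bond bx).toArray
        (quatMat qw qx qy qz refl) (quatNorm qw qx qy qz) i ((certs.drop (6 * i.val)).take 6)) = true
    · refine ⟨quatR qw qx qy qz refl, quatR_orth refl hn, fun i => ?_⟩
      rw [List.all_eq_true] at htest
      exact devTest_sound hN hF hx (hall i (List.mem_finRange i)) hn _ (htest i (List.mem_finRange i))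
    · rw [if_neg htest] at h; exact absurd h (by simp)
  · rw [if_neg hcond] at h; exact absurd h (by simp)

/-! ### Replay induction and the main theorem -/

/-- `applyBound` never reports `verified`. -/
theorem applyBound_ne_verified (m : Model) (bx : Boxes) (st : List Step) (v : Fin 12) (k : Fin 3)
    (up : Bool) (cert : Cert) : applyBound m bx st v k up cert ≠ Outcome.verified := by
  unfold applyBound
  cases bx v with
  | none => simp
  | some B => simp only; split_ifs <;> simp

/-- **Soundness of the replay** (strong induction on the length of the stream, because of the
flat nested sub-streams of `place`). -/
theorem runInstrs_sound {m : Model} (hW : m.WF) (hN : 0 < m.normSq) {x : Fin 12 → Fin 3 → ℝ}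
    (hF : Feasible m.bond x) :
    ∀ (n : ℕ) (is : List Instr), is.length ≤ n → ∀ (bx : Boxes) (st : List Step), bx.mem x →
      StepsOK m st → runInstrs m bx st is = true → CloseTo m x := by
  intro n
  induction n with
  | zero =>
    intro is hlen bx st _ _ h
    have : is = [] := List.eq_nil_of_length_eq_zero (Nat.le_zero.1 hlen)
    subst this; simp [runInstrs] at h
  | succ n ih =>
    intro is hlen bx st hx hst h
    cases is with
    | nil => simp [runInstrs] at h
    | cons i is =>
      have hlen' : is.length ≤ n := by simp at hlen; omega
      cases i with
      | place terms k =>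
        rw [runInstrs] at h
        revert h
        cases hpb : placeBoxes bx st with
        | none => simp
        | some r =>
          obtain ⟨v, main, alt, rest⟩ := r
          intro h
          simp only [Bool.and_eq_true] at h
          obtain ⟨halt, hmain⟩ := h
          obtain ⟨hcases, hrest⟩ := placeBoxes_sound hW hF hx hst hpb
          rcases hcases with hm | ha
          · exact ih (is.drop k) (le_trans (by rw [List.length_drop]; omega) hlen') _ rest
              (mem_update hx v hm) hrest hmain
          · -- `x v` on the alternative branch: it must be refuted or verified by the sub-stream
            have hxAlt := mem_update hx v ha
            by_cases hci : certInfeasible (Function.update bx v (some alt))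
                (rowsOf m.bond (Function.update bx v (some alt))).toArray terms = true
            · exact absurd (prune_sound hF hxAlt terms) (by rw [hci]; simp)
            · rw [if_neg hci] at halt
              exact ih (is.take k) (le_trans (by rw [List.length_take]; omega) hlen') _ rest hxAlt hrest halt
      | bound v k up cert =>
        simp only [runInstrs, stepInstr] at h
        obtain ⟨hnp, hrun⟩ := applyBound_sound hF hx st v k up cert
        have hnv := applyBound_ne_verified m bx st v k up cert
        revert h
        cases hab : applyBound m bx st v k up cert with
        | pruned => exact absurd hab hnp
        | verified => exact absurd hab hnv
        | failed => simp
        | running bx' st' =>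
          intro h
          obtain ⟨hx', hst'⟩ := hrun bx' st' hab
          exact ih is hlen' bx' st' hx' (by rw [hst']; exact hst) h
      | prune terms =>
        simp only [runInstrs, stepInstr, prune_sound hF hx terms] at h
        simp at h
      | objective qw qx qy qz refl certs =>
        simp only [runInstrs, stepInstr] at h
        revert h
        cases hab : applyObjective m bx st qw qx qy qz refl certs with
        | pruned => simp [applyObjective] at hab; split_ifs at hab
        | verified => intro _; exact applyObjective_sound hN hF hx st qw qx qy qz refl certs hab
        | failed => simp
        | running bx' st' => simp [applyObjective] at hab; split_ifs at hab

/-- **Soundness of the cell checker.**  If `runCell m c = true` for a well-formed model with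
`normSq > 0`, every feasible configuration in the normal form of `c` is `6/25`-close, label by
label, to an orthogonal image of the pattern. -/
theorem runCell_sound {m : Model} (hW : m.WF) (hN : 0 < m.normSq) {c : Cell} (h : runCell m c = true)
    {x : Fin 12 → Fin 3 → ℝ} (hF : Feasible m.bond x) (hc : InCell m c x) : CloseTo m x := by
  obtain ⟨hnn, hmem⟩ := initBoxes_sound hW hF hc
  unfold runCell at h
  revert h
  cases hib : initBoxes m c with
  | none => simp
  | some ob =>
    cases ob with
    | none => exact absurd hib hnn
    | some bx =>
      intro h
      exact runInstrs_sound hW hN hF c.instrs.length c.instrs le_rfl bx m.steps (hmem bx hib)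
        (stepsOK_of_WF hW) h

end Rig

end Summit.AtomisticToContinuum.Crystallization.Theorems
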